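import Summits.HodgeConjecture.CorCM.Census.TypeStabiliserCharK

/-!
# Cyclic characters `w : G → ℤ/2ᵏ` non-zero on `c`, I: roots of `c`, the even part, and `d₂(G/𝒦) ∈ {0, 1}`

COR-CM (cell `pub-hodgecm2`), count-neutral kernel combinatorics by the binder seat b09 (gen 41; lane CYCLIC-CHARACTER FIBRE LAW, part I of
II — part II `Census/CyclicCharacterFibreLaw.lean` is THE LAW `φ₂ + 2 = β + d`), sequel of this seatʼs `Census/CoinvariantTwist.lean`
(gen 33: the direct products `G = ⟨u⟩ × B`), in lit-andre-3ʼs `𝒦` / `d₂` currency (`Census/TypeStabiliserSubgroup.lean`: `𝒦 = stabGen c =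
⟨c, {g | c ∉ ⟨g⟩}⟩`; `Census/TypeStabiliserIndexTwoRank.lean`: `d₂ = indexTwoRank`, `2 ^ d₂(G/𝒦) = #{H : [G:H] = 2, 𝒦 ≤ H} + 1`), used BY
NAME.  Pure group theory; theorems only (no definition, no `decide` beyond closed identities in `ℤ/2ᵏ`, no certificate, no named fact, no
`sorry`).  HONEST FRAMING: `HC_CM` is NOT proved, here or anywhere in the tree; nothing here is a period or a headline.

THE SETTING («cyclic characters»).  A group `G`, a CENTRAL involution `c`, and an ADDITIVE map `w : G → ℤ/2ᵏ` (`w (PQ) = w P + w Q`,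
hypothesis `hw`) with `k ≥ 2` which is ONTO (`∃ g, w g = 1`) and does NOT kill `c` (`w c ≠ 0`; then `w c = 2ᵏ⁻¹`, `apply_c`).  Intrinsically:
`c` survives in a cyclic quotient `G ↠ ℤ/2ᵏ` of order `≥ 4` — equivalently `c ∉ [G, G]` and `c` is NOT complemented (the complemented
case `k = 1` is gen 31ʼs DIRECT-FACTOR law).  Examples: every direct product `⟨u⟩ × B` of gen 33 (`u` central of order `2ᵏ`, `c = u^{2ᵏ⁻¹}`,
`w` = the `⟨u⟩`-coordinate) — but also every FIBRE PRODUCT `B̄ ×_ε ℤ/2ᵏ` along a character `ε : B̄ ↠ ℤ/2` (`w` = second projection), which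
is a direct product only when `ε` splits off a direct factor `ℤ/2` of `B̄`: the METACYCLIC groups `ℤ/m ⋊ ℤ/2ᵏ = D_m ×_ε ℤ/2ᵏ` (`m` odd; the
column left open by `HOME/pub-hodgecm2-b09/lean-g40/RELATIVE-SPLITTING.md`), every `N ⋊ ℤ/2ᵏ` with `|N|` odd (all finite groups with a
CYCLIC Sylow `2`-subgroup of order `≥ 4` and central involution), `ℤ/4 ⋊ ℤ/4` with `c = y²` or `c = x²y²`, `Q₈ ×_ε ℤ/2ᵏ`, `S₄ ×_{sgn} ℤ/2ᵏ`, … .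

CONTENT (the subgroups enter through membership predicates, as in `Census/CoinvariantTwistLaw.lean`: `E` is «the even part»
`g ∈ E ↔ 2 ∣ (w g).val`).
* §1 additive maps into `ℤ/2ᵏ`: `w 1 = 0`, `w g⁻¹ = −w g`, `w (gⁿ) = n • w g`, and **`w c = 2ᵏ⁻¹`** (`apply_c`: `w c + w c = 0`, `w c ≠ 0`,
  and `x + x = 0` in `ℤ/2ᵏ` forces `x ∈ {0, 2ᵏ⁻¹}`, `add_self_eq_zero_iff`).
* §2 **`ker w ≤ 𝒦`**: `w` vanishes on `⟨g⟩` when `w g = 0`, so `c ∉ ⟨g⟩` (`mem_stabGen_of_apply_eq_zero`).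
* §3 THE EVEN PART `E`: contains `c` (`k ≥ 2`), the kernel and all squares, has index two (witness: any `g₁` with `w g₁ = 1`), and is
  **the ONLY subgroup of index two containing the kernel** (`eq_even_of_index_two`: such an `H` contains `g₁²` and the kernel, hence `E`).
* §4 hence at most ONE index-two subgroup lies over `𝒦`, and **`d₂(G/𝒦) = 1` iff `𝒦 ≤ E` iff every `g ∉ E` (i.e. `w g` odd) is a ROOT of
  `c`** (`c ∈ ⟨g⟩`; `indexTwoRank_stabGen_eq_one`), **`d₂(G/𝒦) = 0`** as soon as some `g` with `w g` odd is a non-root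
  (`indexTwoRank_stabGen_eq_zero`).  `|G|/2 = |E|` is even (`even_card_div_two`).
* §5 **ODD KERNEL ⇒ every `g` with `w g ≠ 0` is a root of `c`** (`c_mem_zpowers_of_apply_ne_zero`): the involution `ι = g^{ord g/2}` of `⟨g⟩`
  has `w ι = 2ᵏ⁻¹ = w c` (else `ι ∈ ker w` would have odd order), so `ι·c ∈ ker w` is an element of order `≤ 2` and odd order: `ι = c`.
  Hence `d₂(G/𝒦) = 1` for every `N ⋊ ℤ/2ᵏ` with `|N|` odd (`indexTwoRank_stabGen_eq_one_of_odd`), e.g. for the whole metacyclic column.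
Numerics (`HOME/pub-hodgecm2-b09/lean-g41/py/cyclaw.py`): the law of part II, `φ₂ = β − 2 + d`, is exact on `ℤ/3⋊ℤ/8` (171/172), `Dic₃`, `Dic₅`,
`ℤ/4×S₃`, `ℤ/4⋊ℤ/4` (`c = y²`: 18/19, `d = 1`; `c = x²y²`: 19/21, `d = 0`), `Q₈ ×_ε ℤ/4` (19/21, `d = 0`), `ℤ/8⋊ℤ/4` (2066/2067; `c = x⁴y²`:
2073/2075), `Q₈ ×_ε ℤ/8`, `D₄ ×_ε ℤ/8` (two `ε`), `ℤ/4 ⋊ ℤ/8` (all 2067/2068 resp. 2095/2096).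

## References
* [Pohlmann1968] H. Pohlmann, Algebraic cycles on abelian varieties of complex multiplication type, Ann. of Math. 88 (1968), Thm 1
  (the Hodge ring of a CM abelian variety of Galois CM type as the `G`-coinvariant lattice; `φ₂`, `β`, `𝒦` are its bookkeeping).
* [Milne1999] J. S. Milne, Lefschetz motives and the Tate conjecture, Compositio Math. 117 (1999), Prop. 2.1, p. 54.
-/

namespace Summit.HodgeConjecture.CorCM.Census.CyclicCharacter

open Summit.HodgeConjecture.CorCM.Census.TypeStabiliser
open Summit.HodgeConjecture.CorCM.Census.IndexTwo

section GroupOnly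

variable {G : Type*} [Group G] {k : ℕ} {w : G → ZMod (2 ^ k)} {c : G}

/-! ## §1 Additive maps `w : G → ℤ/2ᵏ` -/

/-- An additive map sends `1` to `0`. [folklore] -/
theorem map_one (hw : ∀ P Q : G, w (P * Q) = w P + w Q) : w 1 = 0 := by
  have h : w 1 + 0 = w 1 + w 1 := by rw [add_zero, ← hw, one_mul]
  exact (add_left_cancel h).symm

/-- An additive map sends inverses to negatives. [folklore] -/
theorem map_inv (hw : ∀ P Q : G, w (P * Q) = w P + w Q) (g : G) : w g⁻¹ = -w g :=
  eq_neg_of_add_eq_zero_left (by rw [← hw, inv_mul_cancel, map_one hw])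

/-- An additive map on powers: `w (gⁿ) = n • w g`. [folklore] -/
theorem map_pow (hw : ∀ P Q : G, w (P * Q) = w P + w Q) (g : G) (n : ℕ) : w (g ^ n) = n • w g := by
  induction n with
  | zero => rw [pow_zero, map_one hw, zero_smul]
  | succ n ih => rw [pow_succ, hw, ih, succ_nsmul]

/-- An additive map on integer powers: `w (gⁿ) = n • w g`. [folklore] -/
theorem map_zpow (hw : ∀ P Q : G, w (P * Q) = w P + w Q) (g : G) (n : ℤ) : w (g ^ n) = n • w g := by
  cases n with
  | ofNat n => rw [Int.ofNat_eq_natCast, zpow_natCast, map_pow hw, natCast_zsmul]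
  | negSucc n => rw [zpow_negSucc, map_inv hw, map_pow hw, negSucc_zsmul]

/-- **`w` vanishes on `⟨g⟩` as soon as `w g = 0`.** [folklore] -/
theorem map_eq_zero_of_mem_zpowers (hw : ∀ P Q : G, w (P * Q) = w P + w Q) {g x : G} (hg : w g = 0)
    (hx : x ∈ Subgroup.zpowers g) : w x = 0 := by
  obtain ⟨n, rfl⟩ := Subgroup.mem_zpowers_iff.mp hx
  rw [map_zpow hw, hg, smul_zero]

/-- `2ᵏ⁻¹ < 2ᵏ` for `k ≥ 1`. [folklore] -/
theorem two_pow_pred_lt (hk : 1 ≤ k) : 2 ^ (k - 1) < 2 ^ k :=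
  Nat.pow_lt_pow_right (by norm_num) (by omega)

/-- The value of `2ᵏ⁻¹ ∈ ℤ/2ᵏ` is `2ᵏ⁻¹` (`k ≥ 1`). [folklore] -/
theorem val_two_pow_pred (hk : 1 ≤ k) : (((2 ^ (k - 1) : ℕ) : ZMod (2 ^ k))).val = 2 ^ (k - 1) := by
  rw [ZMod.val_natCast, Nat.mod_eq_of_lt (two_pow_pred_lt hk)]

/-- **In `ℤ/2ᵏ` (`k ≥ 1`), `x + x = 0` iff `x = 0` or `x = 2ᵏ⁻¹`.** [folklore] -/
theorem add_self_eq_zero_iff (hk : 1 ≤ k) (x : ZMod (2 ^ k)) : x + x = 0 ↔ x = 0 ∨ x = ((2 ^ (k - 1) : ℕ) : ZMod (2 ^ k)) := by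
  haveI : NeZero (2 ^ k) := ⟨pow_ne_zero _ two_ne_zero⟩
  have h2k : 2 ^ k = 2 * 2 ^ (k - 1) := by rw [← pow_succ', Nat.sub_add_cancel hk]
  constructor
  · intro h
    have hval : (x + x).val = 0 := by rw [h, ZMod.val_zero]
    rw [ZMod.val_add] at hval
    have hlt := ZMod.val_lt x
    have hdvd : 2 ^ k ∣ x.val + x.val := Nat.dvd_of_mod_eq_zero hval
    obtain ⟨q, hq⟩ := hdvd
    -- `2 x.val = 2^k q` with `x.val < 2^k`, so `q ≤ 1`
    have hq' : x.val + x.val = 2 * (2 ^ (k - 1) * q) := by rw [← mul_assoc, ← h2k]; exact hq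
    have hq2 : x.val = 2 ^ (k - 1) * q := by omega
    have hq1 : q < 2 := by
      have h : 2 ^ (k - 1) * q < 2 ^ (k - 1) * 2 := by rw [← hq2, mul_comm, ← h2k]; exact hlt
      exact Nat.lt_of_mul_lt_mul_left h
    interval_cases q
    · left
      rw [← ZMod.natCast_zmod_val x, hq2, mul_zero, Nat.cast_zero]
    · right
      rw [← ZMod.natCast_zmod_val x, hq2, mul_one]
  · rintro (rfl | rfl)
    · rw [add_zero]
    · rw [← Nat.cast_add, ← two_mul, ← h2k, ZMod.natCast_self]

/-- **`w c = 2ᵏ⁻¹`** for an additive `w` not killing the involution `c` (`k ≥ 1`). [folklore] -/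
theorem apply_c (hw : ∀ P Q : G, w (P * Q) = w P + w Q) (hk : 1 ≤ k) (hc2 : c * c = 1) (hwc : w c ≠ 0) :
    w c = ((2 ^ (k - 1) : ℕ) : ZMod (2 ^ k)) := by
  have h : w c + w c = 0 := by rw [← hw, hc2, map_one hw]
  exact ((add_self_eq_zero_iff hk _).mp h).resolve_left hwc

/-- The value of `w c` is `2ᵏ⁻¹`. [folklore] -/
theorem val_apply_c (hw : ∀ P Q : G, w (P * Q) = w P + w Q) (hk : 1 ≤ k) (hc2 : c * c = 1) (hwc : w c ≠ 0) :
    (w c).val = 2 ^ (k - 1) := by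
  rw [apply_c hw hk hc2 hwc, val_two_pow_pred hk]

/-! ## §2 The kernel of `w` lies in `𝒦` -/

/-- **`w g = 0 ⇒ g ∈ 𝒦`**: `w` vanishes on `⟨g⟩` but not on `c`, so `c ∉ ⟨g⟩`. [folklore] -/
theorem mem_stabGen_of_apply_eq_zero (hw : ∀ P Q : G, w (P * Q) = w P + w Q) (hwc : w c ≠ 0) {g : G} (hg : w g = 0) :
    g ∈ stabGen c :=
  mem_stabGen_of_notMem_zpowers c fun h => hwc (map_eq_zero_of_mem_zpowers hw hg h)

/-! ## §3 The even part `E = {g | w g even}` -/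

section Even

variable {E : Subgroup G}

/-- Parity of a sum in `ℤ/2ᵏ` (`k ≥ 1`): `2 ∣ (x + y).val ↔ (2 ∣ x.val ↔ 2 ∣ y.val)`. [folklore] -/
theorem two_dvd_val_add_iff (hk : 1 ≤ k) (x y : ZMod (2 ^ k)) : 2 ∣ (x + y).val ↔ (2 ∣ x.val ↔ 2 ∣ y.val) := by
  haveI : NeZero (2 ^ k) := ⟨pow_ne_zero _ two_ne_zero⟩
  have h2 : 2 ∣ 2 ^ k := dvd_pow_self 2 (by omega)
  rw [ZMod.val_add, Nat.dvd_mod_iff h2]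
  omega

/-- **`c ∈ E`** (`k ≥ 2`: `(w c).val = 2ᵏ⁻¹` is even). [folklore] -/
theorem c_mem_even (hE : ∀ g : G, g ∈ E ↔ 2 ∣ (w g).val) (hw : ∀ P Q : G, w (P * Q) = w P + w Q) (hk : 2 ≤ k)
    (hc2 : c * c = 1) (hwc : w c ≠ 0) : c ∈ E := by
  rw [hE, val_apply_c hw (by omega) hc2 hwc]
  exact dvd_pow_self 2 (by omega)

/-- The kernel of `w` lies in `E`. [folklore] -/
theorem mem_even_of_apply_eq_zero (hE : ∀ g : G, g ∈ E ↔ 2 ∣ (w g).val) {g : G} (hg : w g = 0) : g ∈ E := by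
  rw [hE, hg, ZMod.val_zero]
  exact dvd_zero 2

/-- **Squares lie in `E`.** [folklore] -/
theorem mul_self_mem_even (hE : ∀ g : G, g ∈ E ↔ 2 ∣ (w g).val) (hw : ∀ P Q : G, w (P * Q) = w P + w Q) (hk : 1 ≤ k) (g : G) :
    g * g ∈ E := by
  rw [hE, hw, two_dvd_val_add_iff hk]

/-- **`E` has index two** (witness: any `g₁` with `w g₁ = 1`). [folklore] -/
theorem index_even (hE : ∀ g : G, g ∈ E ↔ 2 ∣ (w g).val) (hw : ∀ P Q : G, w (P * Q) = w P + w Q) (hk : 1 ≤ k)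
    (h1 : ∃ g₁ : G, w g₁ = 1) : E.index = 2 := by
  haveI : NeZero (2 ^ k) := ⟨pow_ne_zero _ two_ne_zero⟩
  haveI : Fact (1 < 2 ^ k) := ⟨Nat.one_lt_two_pow (by omega)⟩
  obtain ⟨g₁, hg₁⟩ := h1
  rw [Subgroup.index_eq_two_iff]
  refine ⟨g₁, fun b => ?_⟩
  rw [hE, hE, hw, two_dvd_val_add_iff hk, hg₁, ZMod.val_one]
  have h12 : ¬ (2 ∣ 1) := by omega
  unfold Xor
  by_cases hb : 2 ∣ (w b).val
  · exact Or.inr ⟨hb, fun h => h12 (h.mp hb)⟩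
  · exact Or.inl ⟨⟨fun h => absurd h hb, fun h => absurd h h12⟩, hb⟩

/-- **`E` lies in every index-two subgroup `H` containing the kernel of `w`**: for `e ∈ E`, `(w e).val = 2n` and `e·(g₁²)⁻ⁿ ∈ ker w ≤ H`,
`g₁² ∈ H`. [folklore] -/
theorem even_le_of_index_two (hE : ∀ g : G, g ∈ E ↔ 2 ∣ (w g).val) (hw : ∀ P Q : G, w (P * Q) = w P + w Q)
    (h1 : ∃ g₁ : G, w g₁ = 1) {H : Subgroup G} (hH : H.index = 2) (hK : ∀ g : G, w g = 0 → g ∈ H) : E ≤ H := by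
  haveI : NeZero (2 ^ k) := ⟨pow_ne_zero _ two_ne_zero⟩
  obtain ⟨g₁, hg₁⟩ := h1
  intro e he
  obtain ⟨n, hn⟩ := (hE e).mp he
  set x : G := (g₁ * g₁) ^ n with hx
  have hwx : w x = w e := by
    rw [hx, map_pow hw, hw, hg₁, ← ZMod.natCast_zmod_val (w e), hn, nsmul_eq_mul]
    push_cast
    ring
  have hxH : x ∈ H := H.pow_mem (Subgroup.mul_self_mem_of_index_two hH g₁) n
  have hex : e * x⁻¹ ∈ H := hK _ (by rw [hw, map_inv hw, hwx, add_neg_cancel])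
  have : e = e * x⁻¹ * x := by rw [inv_mul_cancel_right]
  rw [this]
  exact H.mul_mem hex hxH

/-- **`E` is the ONLY index-two subgroup containing the kernel of `w`.** [folklore] -/
theorem eq_even_of_index_two (hE : ∀ g : G, g ∈ E ↔ 2 ∣ (w g).val) (hw : ∀ P Q : G, w (P * Q) = w P + w Q) (hk : 1 ≤ k)
    (h1 : ∃ g₁ : G, w g₁ = 1) {H : Subgroup G} (hH : H.index = 2) (hK : ∀ g : G, w g = 0 → g ∈ H) : H = E := by
  have hle : E ≤ H := even_le_of_index_two hE hw h1 hH hK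
  have hrel := Subgroup.relIndex_mul_index hle
  rw [hH, index_even hE hw hk h1] at hrel
  have h1' : E.relIndex H = 1 := by omega
  exact le_antisymm (Subgroup.relIndex_eq_one.mp h1') hle

/-! ## §4 `d₂(G/𝒦) ∈ {0, 1}`: the index-two subgroups over `𝒦` -/

/-- **`𝒦 ≤ E ↔` every `g ∉ E` is a root of `c`** (`k ≥ 2`, so that `c ∈ E`). [folklore] -/
theorem stabGen_le_even_iff (hE : ∀ g : G, g ∈ E ↔ 2 ∣ (w g).val) (hw : ∀ P Q : G, w (P * Q) = w P + w Q) (hk : 2 ≤ k)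
    (hc2 : c * c = 1) (hwc : w c ≠ 0) : stabGen c ≤ E ↔ ∀ g : G, g ∉ E → c ∈ Subgroup.zpowers g := by
  rw [stabGen_le_iff_subset]
  constructor
  · rintro ⟨-, h⟩ g hg
    by_contra hc
    exact hg (h g hc)
  · intro h
    refine ⟨c_mem_even hE hw hk hc2 hwc, fun g hg => ?_⟩
    by_contra hgE
    exact hg (h g hgE)

/-- An index-two subgroup over `𝒦` is the even part. [folklore] -/
theorem eq_even_of_stabGen_le (hE : ∀ g : G, g ∈ E ↔ 2 ∣ (w g).val) (hw : ∀ P Q : G, w (P * Q) = w P + w Q) (hk : 1 ≤ k)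
    (h1 : ∃ g₁ : G, w g₁ = 1) (hwc : w c ≠ 0) {H : Subgroup G} (hH : H.index = 2) (hKH : stabGen c ≤ H) : H = E :=
  eq_even_of_index_two hE hw hk h1 hH fun _ hg => hKH (mem_stabGen_of_apply_eq_zero hw hwc hg)

/-- **Exactly one index-two subgroup lies over `𝒦`** when every `g ∉ E` is a root of `c`. [folklore] -/
theorem card_indexTwoOver_stabGen_eq_one (hE : ∀ g : G, g ∈ E ↔ 2 ∣ (w g).val) (hw : ∀ P Q : G, w (P * Q) = w P + w Q)
    (hk : 2 ≤ k) (h1 : ∃ g₁ : G, w g₁ = 1) (hc2 : c * c = 1) (hwc : w c ≠ 0)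
    (hroots : ∀ g : G, g ∉ E → c ∈ Subgroup.zpowers g) :
    Nat.card {H : Subgroup G // H.index = 2 ∧ stabGen c ≤ H} = 1 := by
  rw [Nat.card_eq_one_iff_exists]
  refine ⟨⟨E, index_even hE hw (by omega) h1, (stabGen_le_even_iff hE hw hk hc2 hwc).mpr hroots⟩, ?_⟩
  rintro ⟨H, hH, hKH⟩
  exact Subtype.ext (eq_even_of_stabGen_le hE hw (by omega) h1 hwc hH hKH)

/-- **No index-two subgroup lies over `𝒦`** when some `g ∉ E` is a non-root of `c`. [folklore] -/
theorem card_indexTwoOver_stabGen_eq_zero (hE : ∀ g : G, g ∈ E ↔ 2 ∣ (w g).val) (hw : ∀ P Q : G, w (P * Q) = w P + w Q)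
    (hk : 2 ≤ k) (h1 : ∃ g₁ : G, w g₁ = 1) (hwc : w c ≠ 0)
    (hnon : ∃ g : G, g ∉ E ∧ c ∉ Subgroup.zpowers g) :
    Nat.card {H : Subgroup G // H.index = 2 ∧ stabGen c ≤ H} = 0 := by
  haveI : IsEmpty {H : Subgroup G // H.index = 2 ∧ stabGen c ≤ H} := ⟨fun ⟨H, hH, hKH⟩ => by
    obtain ⟨g, hgE, hgc⟩ := hnon
    have hHE := eq_even_of_stabGen_le hE hw (by omega) h1 hwc hH hKH
    exact hgE (hHE ▸ hKH (mem_stabGen_of_notMem_zpowers c hgc))⟩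
  exact Nat.card_of_isEmpty

/-- **`d₂(G/𝒦) = 1`** when every `g` with `w g` odd is a root of `c` (`c` central, `k ≥ 2`, `w` onto, `w c ≠ 0`). [folklore] -/
theorem indexTwoRank_stabGen_eq_one [Finite G] (hE : ∀ g : G, g ∈ E ↔ 2 ∣ (w g).val) (hw : ∀ P Q : G, w (P * Q) = w P + w Q)
    (hk : 2 ≤ k) (h1 : ∃ g₁ : G, w g₁ = 1) (hc2 : c * c = 1) (hcen : ∀ x : G, x * c = c * x) (hwc : w c ≠ 0)
    (hroots : ∀ g : G, g ∉ E → c ∈ Subgroup.zpowers g) : indexTwoRank (stabGen c) = 1 := by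
  have h := two_pow_indexTwoRank_stabGen c hcen
  rw [card_indexTwoOver_stabGen_eq_one hE hw hk h1 hc2 hwc hroots] at h
  exact Nat.pow_right_injective (le_refl 2) (h.trans (pow_one 2).symm)

/-- **`d₂(G/𝒦) = 0`** when some `g` with `w g` odd is a non-root of `c`. [folklore] -/
theorem indexTwoRank_stabGen_eq_zero [Finite G] (hE : ∀ g : G, g ∈ E ↔ 2 ∣ (w g).val) (hw : ∀ P Q : G, w (P * Q) = w P + w Q)
    (hk : 2 ≤ k) (h1 : ∃ g₁ : G, w g₁ = 1) (hcen : ∀ x : G, x * c = c * x) (hwc : w c ≠ 0)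
    (hnon : ∃ g : G, g ∉ E ∧ c ∉ Subgroup.zpowers g) : indexTwoRank (stabGen c) = 0 := by
  have h := two_pow_indexTwoRank_stabGen c hcen
  rw [card_indexTwoOver_stabGen_eq_zero hE hw hk h1 hwc hnon, zero_add] at h
  exact Nat.pow_right_injective (le_refl 2) (h.trans (pow_zero 2).symm)

/-- **`d₂(G/𝒦) ≤ 1`** for every cyclic character non-zero on `c`. [folklore] -/
theorem indexTwoRank_stabGen_le_one [Finite G] (hE : ∀ g : G, g ∈ E ↔ 2 ∣ (w g).val) (hw : ∀ P Q : G, w (P * Q) = w P + w Q)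
    (hk : 2 ≤ k) (h1 : ∃ g₁ : G, w g₁ = 1) (hc2 : c * c = 1) (hcen : ∀ x : G, x * c = c * x) (hwc : w c ≠ 0) :
    indexTwoRank (stabGen c) ≤ 1 := by
  by_cases h : ∀ g : G, g ∉ E → c ∈ Subgroup.zpowers g
  · exact (indexTwoRank_stabGen_eq_one hE hw hk h1 hc2 hcen hwc h).le
  · push Not at h
    exact (indexTwoRank_stabGen_eq_zero hE hw hk h1 hcen hwc h).le.trans zero_le_one

/-- `c ≠ 1` (as `w c ≠ 0 = w 1`). [folklore] -/
theorem c_ne_one (hw : ∀ P Q : G, w (P * Q) = w P + w Q) (hwc : w c ≠ 0) : c ≠ 1 := by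
  rintro rfl
  exact hwc (map_one hw)

/-- **`|G|/2 = |E|` is even**: `E` has index two and contains the involution `c`. [folklore] -/
theorem even_card_div_two [Fintype G] (hE : ∀ g : G, g ∈ E ↔ 2 ∣ (w g).val) (hw : ∀ P Q : G, w (P * Q) = w P + w Q) (hk : 2 ≤ k)
    (h1 : ∃ g₁ : G, w g₁ = 1) (hc2 : c * c = 1) (hwc : w c ≠ 0) : Even (Fintype.card G / 2) := by
  have hidx := Subgroup.index_mul_card E
  rw [index_even hE hw (by omega) h1, Nat.card_eq_fintype_card (α := G)] at hidx
  have hE2 : Fintype.card G / 2 = Nat.card E := by omega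
  rw [hE2, even_iff_two_dvd]
  have hc : orderOf c = 2 := orderOf_eq_prime (by rw [pow_two, hc2]) (c_ne_one hw hwc)
  rw [← hc]
  exact Subgroup.orderOf_dvd_natCard E (c_mem_even hE hw hk hc2 hwc)

end Even

/-! ## §5 Odd kernel: every element outside the kernel is a root of `c` -/

/-- If every element of the kernel of `w` has odd order, an element of EVEN order is not in the kernel. [folklore] -/
theorem apply_ne_zero_of_even_orderOf (hodd : ∀ g : G, w g = 0 → Odd (orderOf g)) {g : G} (hg : Even (orderOf g)) : w g ≠ 0 :=
  fun h => (Nat.not_even_iff_odd.mpr (hodd g h)) hg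

/-- An element outside the kernel has EVEN order (`w g ≠ 0` has additive order a power of `2` dividing `ord g`). [folklore] -/
theorem even_orderOf_of_apply_ne_zero [Finite G] (hw : ∀ P Q : G, w (P * Q) = w P + w Q) {g : G} (hg : w g ≠ 0) :
    Even (orderOf g) := by
  haveI : NeZero (2 ^ k) := ⟨pow_ne_zero _ two_ne_zero⟩
  by_contra hodd
  rw [Nat.not_even_iff_odd] at hodd
  apply hg
  have h1 : addOrderOf (w g) ∣ orderOf g := by
    rw [addOrderOf_dvd_iff_nsmul_eq_zero, ← map_pow hw, pow_orderOf_eq_one, map_one hw]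
  have h2 : addOrderOf (w g) ∣ 2 ^ k := by
    have h := addOrderOf_dvd_card (x := w g)
    rwa [ZMod.card] at h
  have hcop : Nat.Coprime (orderOf g) (2 ^ k) := Nat.Coprime.pow_right k (Odd.coprime_two_right hodd)
  exact AddMonoid.addOrderOf_eq_one_iff.mp ((Nat.Coprime.coprime_dvd_left h1 hcop).eq_one_of_dvd h2)

/-- **ODD KERNEL ⇒ every `g` with `w g ≠ 0` is a root of `c`.**  The involution `ι = g^{ord g / 2}` of `⟨g⟩` is outside the kernel
(its order `2` is even), so `w ι = 2ᵏ⁻¹ = w c`; then `ι·c` lies in the kernel, has odd order and `(ι c)² = 1`: `ι c = 1`, `c = ι ∈ ⟨g⟩`.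
[folklore] -/
theorem c_mem_zpowers_of_apply_ne_zero [Finite G] (hw : ∀ P Q : G, w (P * Q) = w P + w Q) (hk : 1 ≤ k) (hc2 : c * c = 1)
    (hcen : ∀ x : G, x * c = c * x) (hwc : w c ≠ 0) (hodd : ∀ g : G, w g = 0 → Odd (orderOf g)) {g : G} (hg : w g ≠ 0) :
    c ∈ Subgroup.zpowers g := by
  obtain ⟨m, hm⟩ := even_orderOf_of_apply_ne_zero hw hg
  have hm2 : orderOf g = 2 * m := by omega
  have hmpos : 0 < m := by
    have := orderOf_pos g
    omega
  set ι : G := g ^ m with hι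
  have hι2 : ι ^ 2 = 1 := by rw [hι, ← pow_mul, mul_comm, ← hm2, pow_orderOf_eq_one]
  have hι1 : ι ≠ 1 := pow_ne_one_of_lt_orderOf hmpos.ne' (by omega)
  have hordι : orderOf ι = 2 := orderOf_eq_prime hι2 hι1
  have hwι : w ι ≠ 0 := apply_ne_zero_of_even_orderOf hodd (by rw [hordι]; exact even_two)
  have hwι' : w ι = w c := by
    rw [apply_c hw hk hc2 hwc]
    have h : w ι + w ι = 0 := by rw [← hw, ← pow_two, hι2, map_one hw]
    exact ((add_self_eq_zero_iff hk _).mp h).resolve_left hwι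
  -- `ι c` is in the kernel and squares to `1`
  have hker : w (ι * c) = 0 := by
    rw [hw, hwι', apply_c hw hk hc2 hwc, ← Nat.cast_add, ← two_mul, ← pow_succ', Nat.sub_add_cancel hk, ZMod.natCast_self]
  have hsq : ι * c * (ι * c) = 1 := by
    calc ι * c * (ι * c) = ι * (c * ι) * c := by simp only [mul_assoc]
      _ = ι * (ι * c) * c := by rw [← hcen ι]
      _ = (ι * ι) * (c * c) := by simp only [mul_assoc]
      _ = 1 := by rw [← pow_two, hι2, one_mul, hc2]
  have hιc : ι * c = 1 := by
    by_contra hne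
    have h2 : orderOf (ι * c) = 2 := orderOf_eq_prime (by rw [pow_two, hsq]) hne
    have := hodd _ hker
    rw [h2] at this
    exact (Nat.not_even_iff_odd.mpr this) even_two
  have hc : c = ι := by
    have : ι * c * c = c := by rw [hιc, one_mul]
    rw [mul_assoc, hc2, mul_one] at this
    exact this.symm
  rw [hc, hι]
  exact Subgroup.pow_mem _ (Subgroup.mem_zpowers g) m

/-- **ODD KERNEL ⇒ `d₂(G/𝒦) = 1`** (`k ≥ 2`, `w` onto, `c` central with `w c ≠ 0`): every `N ⋊ ℤ/2ᵏ` with `|N|` odd — the metacyclic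
column `ℤ/m ⋊ ℤ/2ᵏ`, the dicyclic `Dic_m` (`m` odd), every group with cyclic Sylow `2`-subgroup and central involution. [folklore] -/
theorem indexTwoRank_stabGen_eq_one_of_odd [Finite G] {E : Subgroup G} (hE : ∀ g : G, g ∈ E ↔ 2 ∣ (w g).val)
    (hw : ∀ P Q : G, w (P * Q) = w P + w Q) (hk : 2 ≤ k) (h1 : ∃ g₁ : G, w g₁ = 1) (hc2 : c * c = 1)
    (hcen : ∀ x : G, x * c = c * x) (hwc : w c ≠ 0) (hodd : ∀ g : G, w g = 0 → Odd (orderOf g)) :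
    indexTwoRank (stabGen c) = 1 :=
  indexTwoRank_stabGen_eq_one hE hw hk h1 hc2 hcen hwc fun g hg =>
    c_mem_zpowers_of_apply_ne_zero hw (by omega) hc2 hcen hwc hodd fun h => hg (mem_even_of_apply_eq_zero hE h)

/-- **ODD KERNEL ⇒ the non-roots of `c` are EXACTLY the kernel of `w`.** [folklore] -/
theorem notMem_zpowers_iff_apply_eq_zero [Finite G] (hw : ∀ P Q : G, w (P * Q) = w P + w Q) (hk : 1 ≤ k) (hc2 : c * c = 1)
    (hcen : ∀ x : G, x * c = c * x) (hwc : w c ≠ 0) (hodd : ∀ g : G, w g = 0 → Odd (orderOf g)) (g : G) :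
    c ∉ Subgroup.zpowers g ↔ w g = 0 := by
  constructor
  · intro h
    by_contra hg
    exact h (c_mem_zpowers_of_apply_ne_zero hw hk hc2 hcen hwc hodd hg)
  · intro hg h
    exact hwc (map_eq_zero_of_mem_zpowers hw hg h)

/-- **ODD KERNEL ⇒ `𝒦 = ker w · ⟨c⟩`**: `g ∈ 𝒦 ↔ w g = 0 ∨ w g = w c` (for any subgroup `K₁` with this membership). [folklore] -/
theorem stabGen_eq_of_odd [Finite G] {K₁ : Subgroup G} (hK₁ : ∀ g : G, g ∈ K₁ ↔ w g = 0 ∨ w g = w c)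
    (hw : ∀ P Q : G, w (P * Q) = w P + w Q) (hk : 1 ≤ k) (hc2 : c * c = 1) (hcen : ∀ x : G, x * c = c * x) (hwc : w c ≠ 0)
    (hodd : ∀ g : G, w g = 0 → Odd (orderOf g)) : stabGen c = K₁ := by
  apply le_antisymm
  · rw [stabGen_le_iff_subset]
    refine ⟨(hK₁ c).mpr (Or.inr rfl), fun g hg => (hK₁ g).mpr (Or.inl ((notMem_zpowers_iff_apply_eq_zero hw hk hc2 hcen hwc hodd g).mp hg))⟩
  · intro g hg
    rcases (hK₁ g).mp hg with h | h
    · exact mem_stabGen_of_apply_eq_zero hw hwc h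
    · -- `g = (g c) · c` with `g c` in the kernel
      have hgc : w (g * c) = 0 := by
        rw [hw, h, apply_c hw hk hc2 hwc, ← Nat.cast_add, ← two_mul, ← pow_succ', Nat.sub_add_cancel hk, ZMod.natCast_self]
      have e : g = g * c * c := by rw [mul_assoc, hc2, mul_one]
      rw [e]
      exact (stabGen c).mul_mem (mem_stabGen_of_apply_eq_zero hw hwc hgc) (self_mem_stabGen c)

end GroupOnly

end Summit.HodgeConjecture.CorCM.Census.CyclicCharacter
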